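import Summits.Parity.GeneralizedHardyLittlewood.Theorems.BeyondDiagonalBeatsQuarter.OffDiagPrincipalLevelBound
import Summits.Parity.GeneralizedHardyLittlewood.Theorems.BeyondDiagonalBeatsQuarter.OffDiagDualLedgerScales
import Summits.Parity.GeneralizedHardyLittlewood.Theorems.BeyondDiagonalBeatsQuarter.OffDiagDualLedgerTools
import Literature.NumberTheory.LFunctions.ExceptionalPrimesPowerSums
import HarnessLib

/-!
# Route `PrimeLevelFamEdge`, crux K_B (stmt-Parity-20343), line `diagonal_kernel_split` rev 4, plan Ω,
# `OffDiagCoreTallCount` stage 2d (line lead 2026-08-28T17:02:08Z (2)): **the principal piece of one level in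
# `ms`-currency — `|levelBody q Δ′ (switchedCell K_P Hf q)| ≤ 31000·(1+A₀)⁴·C⁴·(log q)^{11}·q̂^{Δ′−1+8δ}·mainScaleReal Δ′ q`
# (`q ≥ 40`, `1 < Δ′ ≤ 2`, `Hf ≤ q^{A₀}`, `τ(n) ≤ C n^δ`, `0 ≤ δ < 1/4`) — the «a8P ≈ U × L = q̂^{η}·polylog·ms» row of
# OMEGA-BLUEPRINT §3c / TRANSITION-SIZING §11 as a kernel number (trivial mass, no cancellation), and `abs_coreP_scales_le`**
Chain: stage 2c `abs_levelBody_principal_le` ← `boxFactor_le` (`W ≤ 1`, near box ⇒ `≤ 12q̂log²q/c`), `one_add_log_le`,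
`card_nearBoxes_scales_le` (`≤ 121log²q`), `card_divisors_quot_mul_le`, `innerSum_scales_le`, `sum_range_pow_seven_inv_succ_le`
(`≤ 8 log q`), `sum_abs_coeff_tau_sq_le` (`≤ 2C²M^{1/2+2δ}`), `prefactor_mul_qhat_le` (`4πq̂²/q = 1/π ≤ 1/3`),
`mollifier_sq_scales_le`, `qhat_le_log_sq_mul_mainScaleReal`. Bounds only; no def; helper toward `stub_offDiagBelowSlack_io`
(`--supports stmt-Parity-20343`); closes nothing; standard axioms.
«The programme SEARCHES and TYPES; no claim about Landau–Siegel zeros, Theorems 1–2 of arXiv:2211.02515 or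
a repaired Margin232 until a kernel theorem says so.»
-/

noncomputable section

open Real Finset Polynomial
open scoped Real

namespace Summit.Parity.GeneralizedHardyLittlewood.Theorems.BeyondDiagonalBeatsQuarter.OffDiag

open Literature.NumberTheory.LFunctions Literature.NumberTheory.LFunctions.KMV2000
open PeterssonSplit (nearBoxes not_far_of_mem_nearBoxes qhat_sq_le)
open Summit.Parity.GeneralizedHardyLittlewood.Theorems.PrimeLevelFamEdgeIdeaDeltas.PeterssonLayers
  (norm_mollifierCoeff_le)

section Scales

variable {q : ℕ}

/-! ### §1. The cell bound at the scales -/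

/-- **The box factor on a near box**: for `d₁, d₂ ≥ 1` and `i ∈ nearBoxes q d₁ d₂ (log q)⁴`,
`2^{i₂+1}·((3/2)·2^{i₁}·((d₁d₂K₁K₂/4)^{−1/2}·W·c⁻¹·1)) ≤ 12·q̂·(log q)²·c⁻¹` (`W ≤ 1`, `3K/√(dK/4)·… = 6√(K/d) ≤ 6√(dK)`,
`dK < 4q̂²log⁴q`). [folklore] -/
theorem boxFactor_le [NeZero q] {d₁ d₂ : ℕ} (hd₁ : 1 ≤ d₁) (hd₂ : 1 ≤ d₂) {i : ℕ × ℕ}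
    (hi : i ∈ nearBoxes q d₁ d₂ (Real.log q ^ 4)) (c : ℕ) (hc : 1 ≤ c) :
    (2 : ℝ) ^ (i.2 + 1) * (3 / 2 * (2 : ℝ) ^ i.1 *
        (((d₁ : ℝ) * d₂ * ((2 : ℝ) ^ i.1 * 2 ^ i.2) / 4) ^ (-(1 / 2 : ℝ)) *
          cutoffW ((d₁ : ℝ) * d₂ * ((2 : ℝ) ^ i.1 * 2 ^ i.2) / 4 / qhat q ^ 2) * ((c : ℝ))⁻¹ * 1)) ≤
      12 * qhat q * Real.log q ^ 2 * ((c : ℝ))⁻¹ := by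
  have hQ : 0 < qhat q := qhat_pos_of_neZero q
  have hc0 : (0 : ℝ) < c := by exact_mod_cast hc
  set K : ℝ := (2 : ℝ) ^ i.1 * 2 ^ i.2 with hK
  have hK0 : 0 < K := by positivity
  set d : ℝ := (d₁ : ℝ) * d₂ with hd
  have hd1 : 1 ≤ d := by
    have : (1 : ℝ) ≤ d₁ := by exact_mod_cast hd₁
    have : (1 : ℝ) ≤ d₂ := by exact_mod_cast hd₂
    rw [hd]; nlinarith
  have hx0 : 0 < d * K := by positivity
  have hW : cutoffW (d * K / 4 / qhat q ^ 2) ≤ 1 := cutoffW_le_one (by positivity)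
  have hW0 : 0 ≤ cutoffW (d * K / 4 / qhat q ^ 2) := cutoffW_nonneg _
  have hrpow : (d * K / 4) ^ (-(1 / 2 : ℝ)) = 2 * (Real.sqrt (d * K))⁻¹ := by
    rw [Real.rpow_neg (by positivity), ← Real.sqrt_eq_rpow, Real.sqrt_div' _ (by norm_num : (0 : ℝ) ≤ 4),
      show Real.sqrt (4 : ℝ) = 2 by
        rw [show (4 : ℝ) = 2 ^ 2 by norm_num, Real.sqrt_sq (by norm_num : (0 : ℝ) ≤ 2)]]
    have hs : 0 < Real.sqrt (d * K) := Real.sqrt_pos.2 hx0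
    field_simp
  have hnear : d * K < 4 * qhat q ^ 2 * Real.log q ^ 4 := by
    have h := not_far_of_mem_nearBoxes hi
    rw [not_le] at h
    have : (2 : ℝ) ^ (i.1 + i.2) * ((d₁ : ℝ) * d₂) = d * K := by rw [hd, hK, pow_add]; ring
    linarith [this ▸ h]
  have hlog0 : 0 ≤ Real.log q := Real.log_natCast_nonneg q
  have hsqrt : Real.sqrt (d * K) ≤ 2 * qhat q * Real.log q ^ 2 := by
    have h1 : Real.sqrt (d * K) ≤ Real.sqrt (4 * qhat q ^ 2 * Real.log q ^ 4) := Real.sqrt_le_sqrt hnear.le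
    have h2 : Real.sqrt (4 * qhat q ^ 2 * Real.log q ^ 4) = 2 * qhat q * Real.log q ^ 2 := by
      rw [show 4 * qhat q ^ 2 * Real.log q ^ 4 = (2 * qhat q * Real.log q ^ 2) ^ 2 by ring,
        Real.sqrt_sq (by positivity)]
    linarith
  have hs0 : 0 < Real.sqrt (d * K) := Real.sqrt_pos.2 hx0
  have hmain : 3 * K * (2 * (Real.sqrt (d * K))⁻¹) ≤ 6 * Real.sqrt (d * K) := by
    rw [show 3 * K * (2 * (Real.sqrt (d * K))⁻¹) = 6 * K / Real.sqrt (d * K) by ring,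
      div_le_iff₀ hs0, mul_assoc, Real.mul_self_sqrt hx0.le]
    nlinarith
  calc (2 : ℝ) ^ (i.2 + 1) * (3 / 2 * (2 : ℝ) ^ i.1 *
        ((d * K / 4) ^ (-(1 / 2 : ℝ)) * cutoffW (d * K / 4 / qhat q ^ 2) * ((c : ℝ))⁻¹ * 1))
      = 3 * K * ((d * K / 4) ^ (-(1 / 2 : ℝ))) * cutoffW (d * K / 4 / qhat q ^ 2) * ((c : ℝ))⁻¹ := by
        rw [hK, pow_succ]; ring
    _ ≤ 3 * K * ((d * K / 4) ^ (-(1 / 2 : ℝ))) * 1 * ((c : ℝ))⁻¹ := by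
        gcongr
    _ = 3 * K * (2 * (Real.sqrt (d * K))⁻¹) * ((c : ℝ))⁻¹ := by rw [hrpow, mul_one]
    _ ≤ 6 * Real.sqrt (d * K) * ((c : ℝ))⁻¹ := mul_le_mul_of_nonneg_right hmain (inv_nonneg.2 hc0.le)
    _ ≤ 6 * (2 * qhat q * Real.log q ^ 2) * ((c : ℝ))⁻¹ := by gcongr
    _ = 12 * qhat q * Real.log q ^ 2 * ((c : ℝ))⁻¹ := by ring
/-! ### §2. The divisor, height and box-count factors -/

/-- `τ(l/d₁·m/d₂) ≤ τ(l)·τ(m)` for `d₁ ∣ l`, `d₂ ∣ m` (`l, m ≥ 1`). [folklore] -/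
theorem card_divisors_quot_mul_le {l m d₁ d₂ : ℕ} (hl : 1 ≤ l) (hm : 1 ≤ m) (hd₁ : d₁ ∣ l) (hd₂ : d₂ ∣ m) :
    (((l / d₁) * (m / d₂)).divisors.card : ℝ) ≤ (l.divisors.card : ℝ) * m.divisors.card := by
  have h1 : ((l / d₁) * (m / d₂)).divisors.card ≤ (l / d₁).divisors.card * (m / d₂).divisors.card := by
    rw [Nat.divisors_mul]; exact Finset.card_mul_le
  have h2 : (l / d₁).divisors.card ≤ l.divisors.card :=
    Finset.card_le_card (Nat.divisors_subset_of_dvd (by omega) (Nat.div_dvd_of_dvd hd₁))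
  have h3 : (m / d₂).divisors.card ≤ m.divisors.card :=
    Finset.card_le_card (Nat.divisors_subset_of_dvd (by omega) (Nat.div_dvd_of_dvd hd₂))
  exact_mod_cast h1.trans (Nat.mul_le_mul h2 h3)

/-- The height factor: `H ≤ q^{A₀}` (naturals) and `q ≥ 40` give `1 + log H ≤ (1 + A₀)·log q`. [folklore] -/
theorem one_add_log_le (hq : 40 ≤ q) {A₀ H : ℕ} (hH : H ≤ q ^ A₀) :
    1 + Real.log H ≤ (1 + (A₀ : ℝ)) * Real.log q := by
  have hL1 : 1 ≤ Real.log q := one_le_log hq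
  have hlogH : Real.log H ≤ (A₀ : ℝ) * Real.log q := by
    rcases Nat.eq_zero_or_pos H with h0 | h0
    · rw [h0, Nat.cast_zero, Real.log_zero]; positivity
    · calc Real.log H ≤ Real.log ((q : ℝ) ^ A₀) :=
            Real.log_le_log (by exact_mod_cast h0) (by exact_mod_cast hH)
        _ = (A₀ : ℝ) * Real.log q := Real.log_pow _ _
  nlinarith

/-- The near-box count at the scales: `#nearBoxes q d₁ d₂ (log q)⁴ ≤ 121·log²q` (`q ≥ 40`, `d₁d₂ ≥ 1`). [folklore] -/
theorem card_nearBoxes_scales_le (hq : 40 ≤ q) {d₁ d₂ : ℕ} (hd : 1 ≤ d₁ * d₂) :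
    ((nearBoxes q d₁ d₂ (Real.log q ^ 4)).card : ℝ) ≤ 121 * Real.log q ^ 2 := by
  have h1 := card_nearBoxes_le (q := q) hd (Real.log q ^ 4)
  exact le_trans (by exact_mod_cast h1) (natLog_floor_sq_le hq)

/-- **The inner sum of one mollifier pair at the scales.** For `q ≥ 40`, `1 ≤ l, m`, `Hf ≤ q^{A₀}`, `r ∈ ℕ`:
`Σ_{d₁∣l}Σ_{d₂∣m}Σ_{i near} 2τ(ab)(1 + log H)⁴·(box factor at c = r+1) ≤ 2904·(1+A₀)⁴·(log q)⁸·q̂·τ(l)²τ(m)²·(r+1)⁻¹`.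
[folklore] -/
theorem innerSum_scales_le [NeZero q] (hq : 40 ≤ q) {A₀ : ℕ} (Hf : ℕ → ℕ → ℕ → ℕ → ℕ → ℕ → ℕ × ℕ → ℕ)
    (hHf : ∀ d₁ d₂ a b c i, Hf q d₁ d₂ a b c i ≤ q ^ A₀) {l m : ℕ} (hl : 1 ≤ l) (hm : 1 ≤ m) (r : ℕ) :
    ∑ d₁ ∈ l.divisors, ∑ d₂ ∈ m.divisors, ∑ i ∈ nearBoxes q d₁ d₂ (Real.log q ^ 4),
        2 * ((((l / d₁) * (m / d₂) : ℕ)).divisors.card : ℝ) *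
          (1 + Real.log (Hf q d₁ d₂ (l / d₁) (m / d₂) (r + 1) i)) ^ 4 *
          ((2 : ℝ) ^ (i.2 + 1) * (3 / 2 * (2 : ℝ) ^ i.1 *
            (((d₁ : ℝ) * d₂ * ((2 : ℝ) ^ i.1 * 2 ^ i.2) / 4) ^ (-(1 / 2 : ℝ)) *
              cutoffW ((d₁ : ℝ) * d₂ * ((2 : ℝ) ^ i.1 * 2 ^ i.2) / 4 / qhat q ^ 2) *
                (((r + 1 : ℕ) : ℝ))⁻¹ * 1))) ≤
      2904 * (1 + (A₀ : ℝ)) ^ 4 * Real.log q ^ 8 * qhat q *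
        ((l.divisors.card : ℝ) ^ 2 * (m.divisors.card : ℝ) ^ 2) * (((r + 1 : ℕ) : ℝ))⁻¹ := by
  have hQ : 0 < qhat q := qhat_pos_of_neZero q
  have hL1 : 1 ≤ Real.log q := one_le_log hq
  have hr0 : (0 : ℝ) < ((r + 1 : ℕ) : ℝ) := by positivity
  set τl : ℝ := (l.divisors.card : ℝ) with hτl
  set τm : ℝ := (m.divisors.card : ℝ) with hτm
  set X : ℝ := 2 * (τl * τm) * ((1 + (A₀ : ℝ)) * Real.log q) ^ 4 *
    (12 * qhat q * Real.log q ^ 2 * (((r + 1 : ℕ) : ℝ))⁻¹) with hX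
  have hX0 : 0 ≤ X := by positivity
  have hcell : ∀ d₁ ∈ l.divisors, ∀ d₂ ∈ m.divisors, ∀ i ∈ nearBoxes q d₁ d₂ (Real.log q ^ 4),
      2 * ((((l / d₁) * (m / d₂) : ℕ)).divisors.card : ℝ) *
          (1 + Real.log (Hf q d₁ d₂ (l / d₁) (m / d₂) (r + 1) i)) ^ 4 *
          ((2 : ℝ) ^ (i.2 + 1) * (3 / 2 * (2 : ℝ) ^ i.1 *
            (((d₁ : ℝ) * d₂ * ((2 : ℝ) ^ i.1 * 2 ^ i.2) / 4) ^ (-(1 / 2 : ℝ)) *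
              cutoffW ((d₁ : ℝ) * d₂ * ((2 : ℝ) ^ i.1 * 2 ^ i.2) / 4 / qhat q ^ 2) *
                (((r + 1 : ℕ) : ℝ))⁻¹ * 1))) ≤ X := by
    intro d₁ hd₁ d₂ hd₂ i hi
    have hd₁1 : 1 ≤ d₁ := Nat.pos_of_mem_divisors hd₁
    have hd₂1 : 1 ≤ d₂ := Nat.pos_of_mem_divisors hd₂
    have hτ : ((((l / d₁) * (m / d₂) : ℕ)).divisors.card : ℝ) ≤ τl * τm :=
      card_divisors_quot_mul_le hl hm (Nat.dvd_of_mem_divisors hd₁) (Nat.dvd_of_mem_divisors hd₂)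
    have hlog : 1 + Real.log (Hf q d₁ d₂ (l / d₁) (m / d₂) (r + 1) i) ≤ (1 + (A₀ : ℝ)) * Real.log q :=
      one_add_log_le hq (hHf d₁ d₂ (l / d₁) (m / d₂) (r + 1) i)
    have hlog0 : 0 ≤ 1 + Real.log (Hf q d₁ d₂ (l / d₁) (m / d₂) (r + 1) i) := by
      have := Real.log_natCast_nonneg (Hf q d₁ d₂ (l / d₁) (m / d₂) (r + 1) i); linarith
    have hbox := boxFactor_le hd₁1 hd₂1 hi (r + 1) (by omega)
    have hbox0 : 0 ≤ (2 : ℝ) ^ (i.2 + 1) * (3 / 2 * (2 : ℝ) ^ i.1 *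
        (((d₁ : ℝ) * d₂ * ((2 : ℝ) ^ i.1 * 2 ^ i.2) / 4) ^ (-(1 / 2 : ℝ)) *
          cutoffW ((d₁ : ℝ) * d₂ * ((2 : ℝ) ^ i.1 * 2 ^ i.2) / 4 / qhat q ^ 2) *
            (((r + 1 : ℕ) : ℝ))⁻¹ * 1)) := by
      have := cutoffW_nonneg ((d₁ : ℝ) * d₂ * ((2 : ℝ) ^ i.1 * 2 ^ i.2) / 4 / qhat q ^ 2)
      positivity
    rw [hX]
    gcongr
  calc _ ≤ ∑ d₁ ∈ l.divisors, ∑ d₂ ∈ m.divisors, ∑ i ∈ nearBoxes q d₁ d₂ (Real.log q ^ 4), X :=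
        Finset.sum_le_sum fun d₁ hd₁ ↦ Finset.sum_le_sum fun d₂ hd₂ ↦ Finset.sum_le_sum fun i hi ↦
          hcell d₁ hd₁ d₂ hd₂ i hi
    _ ≤ ∑ d₁ ∈ l.divisors, ∑ d₂ ∈ m.divisors, 121 * Real.log q ^ 2 * X := by
        refine Finset.sum_le_sum fun d₁ hd₁ ↦ Finset.sum_le_sum fun d₂ hd₂ ↦ ?_
        rw [Finset.sum_const, nsmul_eq_mul]
        exact mul_le_mul_of_nonneg_right (card_nearBoxes_scales_le hq
          (Nat.mul_pos (Nat.pos_of_mem_divisors hd₁) (Nat.pos_of_mem_divisors hd₂))) hX0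
    _ = τl * τm * (121 * Real.log q ^ 2 * X) := by
        rw [Finset.sum_const, Finset.sum_const, smul_smul, nsmul_eq_mul, hτl, hτm]
        push_cast
        ring
    _ = 2904 * (1 + (A₀ : ℝ)) ^ 4 * Real.log q ^ 8 * qhat q * (τl ^ 2 * τm ^ 2) * (((r + 1 : ℕ) : ℝ))⁻¹ := by
        rw [hX]; ring
/-! ### §3. The `r`-sum and the mollifier sum -/

/-- `Σ_{r < R} (r+1)⁻¹ = H_R ≤ 1 + log R` (Mathlib's `harmonic_le_one_add_log`). [folklore] -/
theorem sum_range_inv_succ_le (R : ℕ) :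
    ∑ r ∈ Finset.range R, (((r + 1 : ℕ) : ℝ))⁻¹ ≤ 1 + Real.log R := by
  have h := harmonic_le_one_add_log R
  have he : ((harmonic R : ℚ) : ℝ) = ∑ r ∈ Finset.range R, (((r + 1 : ℕ) : ℝ))⁻¹ := by
    simp [harmonic]
  rw [he] at h
  exact h

/-- `Σ_{r < q⁷} (r+1)⁻¹ ≤ 8·log q` for `q ≥ 40`. [folklore] -/
theorem sum_range_pow_seven_inv_succ_le (hq : 40 ≤ q) :
    ∑ r ∈ Finset.range (q ^ 7), (((r + 1 : ℕ) : ℝ))⁻¹ ≤ 8 * Real.log q := by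
  have hL1 : 1 ≤ Real.log q := one_le_log hq
  have h := sum_range_inv_succ_le (q ^ 7)
  have hlog : Real.log ((q ^ 7 : ℕ) : ℝ) = 7 * Real.log q := by
    rw [Nat.cast_pow, Real.log_pow]; norm_num
  rw [hlog] at h
  linarith

/-- **The mollifier side**: `Σ_{l ≤ M} |c_l|·τ(l)² ≤ 2C²·M^{1/2+2δ}` for `P = X²`, `M > 1`, `τ(n) ≤ Cn^δ` with
`0 ≤ δ < 1/4` (`|c_l| ≤ l^{−1/2}`, `Σ_{l ≤ N} l^{−(1/2−2δ)} ≤ 1 + (N^{1/2+2δ} − 1)/(1/2+2δ) ≤ 2N^{1/2+2δ}`).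
[cite: KowalskiMichelVanderKam2000, (9) p. 7 — derivation] -/
theorem sum_abs_coeff_tau_sq_le {M : ℝ} (hM : 1 < M) {δ C : ℝ} (hδ0 : 0 ≤ δ) (hδ : δ < 1 / 4)
    (hC : ∀ n : ℕ, ((n.divisors.card : ℕ) : ℝ) ≤ C * (n : ℝ) ^ δ) :
    ∑ l ∈ Finset.Icc 1 ⌊M⌋₊, |mollifierCoeff (X ^ 2) M l| * (l.divisors.card : ℝ) ^ 2 ≤
      2 * C ^ 2 * M ^ (1 / 2 + 2 * δ) := by
  have hC0 : 0 ≤ C := by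
    have h := hC 1
    simp at h
    linarith
  have hM0 : 0 < M := by linarith
  have hN1 : 1 ≤ ⌊M⌋₊ := Nat.one_le_iff_ne_zero.2 (by
    intro h0; have := Nat.floor_eq_zero.1 h0; linarith)
  have hX : ∀ t ∈ Set.Icc (0 : ℝ) 1, |(X ^ 2 : ℝ[X]).eval t| ≤ 1 := by
    intro t ht
    rw [eval_pow, eval_X, abs_pow, abs_of_nonneg ht.1]
    exact pow_le_one₀ ht.1 ht.2
  have hpt : ∀ l ∈ Finset.Icc 1 ⌊M⌋₊,
      |mollifierCoeff (X ^ 2) M l| * (l.divisors.card : ℝ) ^ 2 ≤ C ^ 2 * (l : ℝ) ^ (-(1 / 2 - 2 * δ)) := by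
    intro l hl
    have hl0 : (0 : ℝ) < l := by exact_mod_cast (Finset.mem_Icc.1 hl).1
    have hc := norm_mollifierCoeff_le hX hM hl
    rw [Complex.norm_real, Real.norm_eq_abs, one_mul] at hc
    have h2 : (l.divisors.card : ℝ) ^ 2 ≤ (C * (l : ℝ) ^ δ) ^ 2 :=
      pow_le_pow_left₀ (Nat.cast_nonneg _) (hC l) 2
    calc |mollifierCoeff (X ^ 2) M l| * (l.divisors.card : ℝ) ^ 2
        ≤ (l : ℝ) ^ (-(1 / 2 : ℝ)) * (C * (l : ℝ) ^ δ) ^ 2 :=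
          mul_le_mul hc h2 (by positivity) (Real.rpow_nonneg hl0.le _)
      _ = C ^ 2 * (l : ℝ) ^ (-(1 / 2 - 2 * δ)) := by
          rw [mul_pow, ← Real.rpow_natCast ((l : ℝ) ^ δ) 2, ← Real.rpow_mul hl0.le,
            show -(1 / 2 - 2 * δ) = -(1 / 2 : ℝ) + δ * (2 : ℕ) by push_cast; ring, Real.rpow_add hl0]
          ring
  have hβ0 : 0 ≤ 1 / 2 - 2 * δ := by linarith
  have hβ1 : 1 / 2 - 2 * δ < 1 := by linarith
  have hS := Literature.NumberTheory.LFunctions.SiegelZero.sum_Icc_rpow_le hβ0 hβ1 hN1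
  have hNM : ((⌊M⌋₊ : ℕ) : ℝ) ≤ M := Nat.floor_le hM0.le
  have hpow : ((⌊M⌋₊ : ℕ) : ℝ) ^ (1 - (1 / 2 - 2 * δ)) ≤ M ^ (1 / 2 + 2 * δ) := by
    rw [show 1 - (1 / 2 - 2 * δ) = 1 / 2 + 2 * δ by ring]
    exact Real.rpow_le_rpow (Nat.cast_nonneg _) hNM (by linarith)
  have hM1 : 1 ≤ M ^ (1 / 2 + 2 * δ) := Real.one_le_rpow hM.le (by linarith)
  have hden : 1 / 2 ≤ 1 - (1 / 2 - 2 * δ) := by linarith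
  calc ∑ l ∈ Finset.Icc 1 ⌊M⌋₊, |mollifierCoeff (X ^ 2) M l| * (l.divisors.card : ℝ) ^ 2
      ≤ ∑ l ∈ Finset.Icc 1 ⌊M⌋₊, C ^ 2 * (l : ℝ) ^ (-(1 / 2 - 2 * δ)) := Finset.sum_le_sum hpt
    _ = C ^ 2 * ∑ l ∈ Finset.Icc 1 ⌊M⌋₊, (l : ℝ) ^ (-(1 / 2 - 2 * δ)) := by rw [Finset.mul_sum]
    _ ≤ C ^ 2 * (1 + ((((⌊M⌋₊ : ℕ) : ℝ)) ^ (1 - (1 / 2 - 2 * δ)) - 1) / (1 - (1 / 2 - 2 * δ))) :=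
        mul_le_mul_of_nonneg_left hS (sq_nonneg C)
    _ ≤ C ^ 2 * (2 * M ^ (1 / 2 + 2 * δ)) := by
        refine mul_le_mul_of_nonneg_left ?_ (sq_nonneg C)
        have hnum : (((⌊M⌋₊ : ℕ) : ℝ)) ^ (1 - (1 / 2 - 2 * δ)) - 1 ≤ M ^ (1 / 2 + 2 * δ) - 1 := by linarith
        have hfrac : ((((⌊M⌋₊ : ℕ) : ℝ)) ^ (1 - (1 / 2 - 2 * δ)) - 1) / (1 - (1 / 2 - 2 * δ)) ≤
            (M ^ (1 / 2 + 2 * δ) - 1) / (1 / 2) := by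
          have hn0 : 0 ≤ M ^ (1 / 2 + 2 * δ) - 1 := by linarith
          calc ((((⌊M⌋₊ : ℕ) : ℝ)) ^ (1 - (1 / 2 - 2 * δ)) - 1) / (1 - (1 / 2 - 2 * δ))
              ≤ (M ^ (1 / 2 + 2 * δ) - 1) / (1 - (1 / 2 - 2 * δ)) :=
                div_le_div_of_nonneg_right hnum (by linarith)
            _ ≤ (M ^ (1 / 2 + 2 * δ) - 1) / (1 / 2) :=
                div_le_div_of_nonneg_left hn0 (by norm_num) hden
        linarith
    _ = 2 * C ^ 2 * M ^ (1 / 2 + 2 * δ) := by ring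
/-! ### §4. The principal piece of one level in `ms`-currency -/

/-- `M^{1/2+2δ}` squared and the scales: `(2C²M^{1/2+2δ})² = 4C⁴·(q̂^{Δ′})^{1+4δ} ≤ 4C⁴·q̂^{Δ′−1+8δ}·q̂` for
`M = q̂^{Δ′}`, `q̂ ≥ 1`, `Δ′ ≤ 2`, `δ ≥ 0`. [folklore] -/
theorem mollifier_sq_scales_le (hq : 40 ≤ q) {Δ' : ℝ} (h2 : Δ' ≤ 2) {C δ : ℝ} (hδ0 : 0 ≤ δ) :
    (2 * C ^ 2 * (qhat q ^ Δ') ^ (1 / 2 + 2 * δ)) ^ 2 ≤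
      4 * C ^ 4 * (qhat q ^ (Δ' - 1 + 8 * δ) * qhat q) := by
  have hQ1 : 1 < qhat q := one_lt_qhat hq
  have hQ0 : 0 ≤ qhat q := by linarith
  have hsq : ((qhat q ^ Δ') ^ (1 / 2 + 2 * δ)) ^ 2 = qhat q ^ (Δ' * (1 + 4 * δ)) := by
    rw [← Real.rpow_natCast, ← Real.rpow_mul (Real.rpow_nonneg hQ0 _), ← Real.rpow_mul hQ0]
    congr 1
    push_cast
    ring
  have hexp : qhat q ^ (Δ' * (1 + 4 * δ)) ≤ qhat q ^ (Δ' - 1 + 8 * δ) * qhat q := by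
    rw [← Real.rpow_add_one (by linarith : qhat q ≠ 0)]
    refine Real.rpow_le_rpow_of_exponent_le hQ1.le ?_
    nlinarith
  calc (2 * C ^ 2 * (qhat q ^ Δ') ^ (1 / 2 + 2 * δ)) ^ 2
      = 4 * C ^ 4 * ((qhat q ^ Δ') ^ (1 / 2 + 2 * δ)) ^ 2 := by ring
    _ ≤ 4 * C ^ 4 * (qhat q ^ (Δ' - 1 + 8 * δ) * qhat q) := by
        rw [hsq]
        exact mul_le_mul_of_nonneg_left hexp (by positivity)

/-- `4πq̂/q·q̂ = 1/π ≤ 1/3` (`q̂² = q/(4π²)`). [folklore] -/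
theorem prefactor_mul_qhat_le [NeZero q] : 4 * π * qhat q / q * qhat q ≤ 1 / 3 := by
  have hq0 : (0 : ℝ) < q := by exact_mod_cast Nat.pos_of_ne_zero (NeZero.ne q)
  have h : 4 * π * qhat q / q * qhat q = 1 / π := by
    rw [show 4 * π * qhat q / q * qhat q = 4 * π * qhat q ^ 2 / q by ring, KMV2000.qhat_sq]
    field_simp
  rw [h]
  exact one_div_le_one_div_of_le (by norm_num) Real.pi_gt_three.le

/-- **The principal piece of one level in `ms`-currency** (the «a8P ≈ U × L» kernel number). For `q ≥ 40`,
`1 < Δ′ ≤ 2`, a height function with `Hf q … ≤ q^{A₀}`, and a divisor bound `τ(n) ≤ C·n^δ` with `0 ≤ δ < 1/4`: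
`|levelBody q Δ′ (switchedCell K_P Hf q)| ≤ 31000·(1+A₀)⁴·C⁴·(log q)^{11}·q̂^{Δ′−1+8δ}·mainScaleReal Δ′ q`
— i.e. `q̂^{η}·polylog·ms` up to the `q̂^{8δ}` of the divisor bound: the trivial mass of the whole principal piece
(all dual moduli, tall and short) of `coreP` at one level; NOT `o(ms)`, and no cancellation in `h₁` is claimed.
[cite: KowalskiMichelVanderKam2000, §6 p. 19, (21)–(23) p. 12 — derivation] -/
theorem abs_levelBody_principal_scales_le [NeZero q] (hq : 40 ≤ q) {Δ' : ℝ} (h1 : 1 < Δ') (h2 : Δ' ≤ 2)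
    {A₀ : ℕ} (Hf : ℕ → ℕ → ℕ → ℕ → ℕ → ℕ → ℕ × ℕ → ℕ) (hHf : ∀ d₁ d₂ a b c i, Hf q d₁ d₂ a b c i ≤ q ^ A₀)
    {C δ : ℝ} (hδ0 : 0 ≤ δ) (hδ : δ < 1 / 4) (hC : ∀ n : ℕ, ((n.divisors.card : ℕ) : ℝ) ≤ C * (n : ℝ) ^ δ) :
    |levelBody q Δ' (switchedCell (fun c _ s h₁ q ↦ levelPrincipal {q} (fun _ ↦ (1 : ℂ)) (switchMod c s h₁)) Hf q)| ≤
      31000 * (1 + (A₀ : ℝ)) ^ 4 * C ^ 4 * Real.log q ^ 11 * qhat q ^ (Δ' - 1 + 8 * δ) *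
        mainScaleReal Δ' q := by
  have hq2 : 2 ≤ q := by omega
  have hQ1 : 1 < qhat q := one_lt_qhat hq
  have hQ0 : 0 < qhat q := by linarith
  have hL1 : 1 ≤ Real.log q := one_le_log hq
  have hq0 : (0 : ℝ) < q := by exact_mod_cast (show 0 < q by omega)
  have hC0 : 0 ≤ C := by
    have h := hC 1
    simp at h
    linarith
  set M : ℝ := qhat q ^ Δ' with hM
  have hM1 : 1 < M := Real.one_lt_rpow hQ1 (by linarith)
  set K₁ : ℝ := 2904 * (1 + (A₀ : ℝ)) ^ 4 * Real.log q ^ 8 * qhat q with hK₁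
  have hK₁0 : 0 ≤ K₁ := by positivity
  set S : ℝ := ∑ l ∈ Finset.Icc 1 ⌊M⌋₊, |mollifierCoeff (X ^ 2) M l| * (l.divisors.card : ℝ) ^ 2 with hS
  have hS0 : 0 ≤ S := Finset.sum_nonneg fun l _ ↦ by positivity
  have hSle : S ≤ 2 * C ^ 2 * M ^ (1 / 2 + 2 * δ) := sum_abs_coeff_tau_sq_le hM1 hδ0 hδ hC
  have hR : ∑ r ∈ Finset.range (q ^ 7), (((r + 1 : ℕ) : ℝ))⁻¹ ≤ 8 * Real.log q :=
    sum_range_pow_seven_inv_succ_le hq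
  have hpre0 : 0 ≤ 4 * π * qhat q / q := by positivity
  refine (abs_levelBody_principal_le q hq2 Δ' Hf).trans ?_
  refine (mul_le_mul_of_nonneg_left (c := K₁ * (8 * Real.log q) * (2 * C ^ 2 * M ^ (1 / 2 + 2 * δ)) ^ 2)
    ?_ hpre0).trans ?_
  · -- the big sum
    calc _ ≤ ∑ r ∈ Finset.range (q ^ 7), ∑ l ∈ Finset.Icc 1 ⌊M⌋₊, ∑ m ∈ Finset.Icc 1 ⌊M⌋₊,
          |mollifierCoeff (X ^ 2) M l * mollifierCoeff (X ^ 2) M m| *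
            (K₁ * ((l.divisors.card : ℝ) ^ 2 * (m.divisors.card : ℝ) ^ 2) * (((r + 1 : ℕ) : ℝ))⁻¹) := by
          refine Finset.sum_le_sum fun r _ ↦ Finset.sum_le_sum fun l hl ↦ Finset.sum_le_sum fun m hm ↦ ?_
          exact mul_le_mul_of_nonneg_left
            (innerSum_scales_le hq Hf hHf (Finset.mem_Icc.1 hl).1 (Finset.mem_Icc.1 hm).1 r) (abs_nonneg _)
      _ = ∑ r ∈ Finset.range (q ^ 7), K₁ * (((r + 1 : ℕ) : ℝ))⁻¹ * (S * S) := by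
          refine Finset.sum_congr rfl fun r _ ↦ ?_
          rw [hS, Finset.sum_mul_sum, Finset.mul_sum]
          refine Finset.sum_congr rfl fun l _ ↦ ?_
          rw [Finset.mul_sum]
          refine Finset.sum_congr rfl fun m _ ↦ ?_
          rw [abs_mul]
          ring
      _ = K₁ * (∑ r ∈ Finset.range (q ^ 7), (((r + 1 : ℕ) : ℝ))⁻¹) * (S * S) := by
          conv_rhs => rw [Finset.mul_sum, Finset.sum_mul]
      _ ≤ K₁ * (8 * Real.log q) * (2 * C ^ 2 * M ^ (1 / 2 + 2 * δ)) ^ 2 := by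
          rw [sq]
          exact mul_le_mul (mul_le_mul_of_nonneg_left hR hK₁0) (mul_le_mul hSle hSle hS0 (by positivity))
            (mul_nonneg hS0 hS0) (by positivity)
  · -- the scales
    have hmol := mollifier_sq_scales_le (C := C) hq h2 hδ0
    have hms := qhat_le_log_sq_mul_mainScaleReal hq h1 h2
    have hms0 : 0 ≤ mainScaleReal Δ' q := by
      have : 0 < Real.log q ^ 2 * mainScaleReal Δ' q := lt_of_lt_of_le hQ0 hms
      nlinarith [this]
    have hpow0 : 0 ≤ qhat q ^ (Δ' - 1 + 8 * δ) := Real.rpow_nonneg hQ0.le _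
    have hpref := prefactor_mul_qhat_le (q := q)
    calc 4 * π * qhat q / q * (K₁ * (8 * Real.log q) * (2 * C ^ 2 * M ^ (1 / 2 + 2 * δ)) ^ 2)
        ≤ 4 * π * qhat q / q * (K₁ * (8 * Real.log q) * (4 * C ^ 4 * (qhat q ^ (Δ' - 1 + 8 * δ) * qhat q))) := by
          gcongr
      _ = (4 * π * qhat q / q * qhat q) * (2904 * 8 * 4) * (1 + (A₀ : ℝ)) ^ 4 * C ^ 4 * Real.log q ^ 9 *
            qhat q ^ (Δ' - 1 + 8 * δ) * qhat q := by
          rw [hK₁]; ring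
      _ ≤ (1 / 3) * (2904 * 8 * 4) * (1 + (A₀ : ℝ)) ^ 4 * C ^ 4 * Real.log q ^ 9 *
            qhat q ^ (Δ' - 1 + 8 * δ) * (Real.log q ^ 2 * mainScaleReal Δ' q) := by
          gcongr
      _ = (2904 * 8 * 4 / 3) * (1 + (A₀ : ℝ)) ^ 4 * C ^ 4 * Real.log q ^ 11 *
            qhat q ^ (Δ' - 1 + 8 * δ) * mainScaleReal Δ' q := by ring
      _ ≤ 31000 * (1 + (A₀ : ℝ)) ^ 4 * C ^ 4 * Real.log q ^ 11 * qhat q ^ (Δ' - 1 + 8 * δ) *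
            mainScaleReal Δ' q := by
          gcongr
          norm_num

/-- **`coreP` over a block in `ms`-currency**: for a finite set `G` of levels `q ≥ 40`, `1 < Δ′ ≤ 2`, a height function
with `Hf q … ≤ q^{A₀}` at every `q ∈ G`, and `τ(n) ≤ C·n^δ` (`0 ≤ δ < 1/4`):
`|coreP G Hf Δ′| ≤ Σ_{q∈G} 31000·(1+A₀)⁴·C⁴·(log q)^{11}·q̂^{Δ′−1+8δ}·mainScaleReal Δ′ q` — the (U)-residual's trivial
size as a kernel number (`≈ q̂^{η}·polylog·Σ ms`, NOT `o(Σ ms)`). [cite: KowalskiMichelVanderKam2000, §6 p. 19 — derivation] -/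
theorem abs_coreP_scales_le (G : Finset ℕ) (hG : ∀ q ∈ G, 40 ≤ q) {Δ' : ℝ} (h1 : 1 < Δ') (h2 : Δ' ≤ 2)
    {A₀ : ℕ} (Hf : ℕ → ℕ → ℕ → ℕ → ℕ → ℕ → ℕ × ℕ → ℕ)
    (hHf : ∀ q ∈ G, ∀ d₁ d₂ a b c i, Hf q d₁ d₂ a b c i ≤ q ^ A₀)
    {C δ : ℝ} (hδ0 : 0 ≤ δ) (hδ : δ < 1 / 4) (hC : ∀ n : ℕ, ((n.divisors.card : ℕ) : ℝ) ≤ C * (n : ℝ) ^ δ) :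
    |coreP G Hf Δ'| ≤ ∑ q ∈ G, 31000 * (1 + (A₀ : ℝ)) ^ 4 * C ^ 4 * Real.log q ^ 11 *
      qhat q ^ (Δ' - 1 + 8 * δ) * mainScaleReal Δ' q := by
  refine abs_coreP_le_sum G (fun q hq ↦ by have := hG q hq; omega) Hf Δ' _ fun q hq _ ↦ ?_
  exact abs_levelBody_principal_scales_le (hG q hq) h1 h2 Hf (hHf q hq) hδ0 hδ hC

end Scales



end Summit.Parity.GeneralizedHardyLittlewood.Theorems.BeyondDiagonalBeatsQuarter.OffDiag
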